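import Summits.BirchSwinnertonDyer.BirchSwinnertonDyer.Theses.InertBadSignedBranches
import Summits.BirchSwinnertonDyer.BirchSwinnertonDyer.Theses.QuadraticBranchSignedControl
import Summits.BirchSwinnertonDyer.BirchSwinnertonDyer.Theorems.SchneiderFreeAdditiveX3PoitouTateReciprocitySumHolds
import HarnessLib

set_option linter.dupNamespace false -- `…BirchSwinnertonDyer.BirchSwinnertonDyer…` is the cell's nested layout (D-0017)
set_option autoImplicit false

/-!
# Item 19417 `PoitouTateRealRat` (route `InertBadSignedBranches`, support 906) = `PublishedInputPoitouTateReal` (route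
# `QuadraticBranchSignedControl`, support 905) — Poitou–Tate duality for Selmer structures over `ℚ`, real-place-injective family —
# PROVED BY NAME (LADDER-BSD D-0154 (2), INPUTS TRANCHE #3b)

Seat `bsd-inputs-honda-p1` (gen 6, idle INPUTS prover of the desk `pub/bsd-wall/bsd-inputs`), `--workitem` stmt-BirchSwinnertonDyer-19417.
THEOREMS ONLY (no definition, no named fact, no `sorry`).

The item is the named published fact `Literature.NumberTheory.GaloisCohomology.poitouTate_selmerStructure_duality_real ℚ` (the five-conjunct
form: `IsPerfect ∧ SumLocalTermEqZero ∧ UnramifiedOrthogonal ∧ SelmerComplement ∧ InjectiveAtRealPlaces` for one family of local invariant maps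
at every level; Milne *ADT* I Example 1.6 (c), Cor. 2.3, Thm. 2.6, Thm. 4.10 (b); Howard 2004 Thm. 2.1.11). Since 2026-08-28T11:03Z it is the
`K = ℚ` instance of a THEOREM OF THE TREE:
`Summit.BirchSwinnertonDyer.BirchSwinnertonDyer.Theorems.SchneiderFreeAdditiveX3.PoitouTateReduction.poitouTate_selmerStructure_duality_real_holds
(K : Type) [Field K] [NumberField K]` (cell `bsd-schneider`, door-c4 g18, p626891, module `Theorems.SchneiderFreeAdditiveX3PoitouTateReciprocitySumHolds`).
This leaf file records it against the two route declarations carrying item 19417 (one item by dedup; both `def … : Prop :=` aliases of the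
signature) by `unfold; exact`. Nothing is re-derived; no landed declaration is restated.

Honest framing: UNCONDITIONAL (classical Poitou–Tate duality, kernel-checked by the `bsd-schneider` cell). Closing item 19417 discharges conjunct
5 of `PublishedInputsGss2` / the `hPT`-type binder of the two routes' exact-control discharges AS TYPED only; the routes' cruxes are not
proved; no summit statement is proved; the Birch–Swinnerton-Dyer conjecture is NOT proved by any of this.
References: [MilneADT2006] Ch. I, Example 1.6 (c), Thm. 4.10 (b); [Howard2004HeegnerKolyvagin] Thm. 2.1.11.
-/

namespace Summit.BirchSwinnertonDyer.BirchSwinnertonDyer.Theorems.InputsPoitouTateSelmer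

open Literature.NumberTheory.GaloisCohomology

/-- **Item 19417 on route `InertBadSignedBranches` — `PoitouTateRealRat` PROVED (by name):** `poitouTate_selmerStructure_duality_real ℚ`,
the `K = ℚ` instance of `SchneiderFreeAdditiveX3.PoitouTateReduction.poitouTate_selmerStructure_duality_real_holds` (p626891). Unconditional;
closes item 19417; BSD is not proved by this. [cite: MilneADT2006, Ch. I, Example 1.6 (c) (p. 19) and Thm. 4.10 (b) (p. 57)]
[cite: Howard2004HeegnerKolyvagin, Thm. 2.1.11 (arXiv:1202.6340 p. 6)] -/
theorem inertBadSignedBranches_poitouTateRealRat_proof :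
    Summit.BirchSwinnertonDyer.BirchSwinnertonDyer.Theses.InertBadSignedBranches.PoitouTateRealRat := by
  unfold Summit.BirchSwinnertonDyer.BirchSwinnertonDyer.Theses.InertBadSignedBranches.PoitouTateRealRat
  exact SchneiderFreeAdditiveX3.PoitouTateReduction.poitouTate_selmerStructure_duality_real_holds ℚ

/-- **Item 19417 on route `QuadraticBranchSignedControl` — the same item (one item by dedup), `PublishedInputPoitouTateReal` PROVED (by
name):** `poitouTate_selmerStructure_duality_real ℚ` from `…poitouTate_selmerStructure_duality_real_holds ℚ`. Unconditional; BSD is not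
proved by this. [cite: MilneADT2006, Ch. I, Example 1.6 (c) (p. 19) and Thm. 4.10 (b) (p. 57)] [cite: Howard2004HeegnerKolyvagin, Thm. 2.1.11 (arXiv:1202.6340 p. 6)] -/
theorem quadraticBranchSignedControl_publishedInputPoitouTateReal_proof :
    Summit.BirchSwinnertonDyer.BirchSwinnertonDyer.Theses.QuadraticBranchSignedControl.PublishedInputPoitouTateReal := by
  unfold Summit.BirchSwinnertonDyer.BirchSwinnertonDyer.Theses.QuadraticBranchSignedControl.PublishedInputPoitouTateReal
  exact SchneiderFreeAdditiveX3.PoitouTateReduction.poitouTate_selmerStructure_duality_real_holds ℚ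

end Summit.BirchSwinnertonDyer.BirchSwinnertonDyer.Theorems.InputsPoitouTateSelmer
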